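import Literature.Analysis.FluidPDE.JetAxialProfile
import Literature.Analysis.FluidPDE.MikadoRescaled
import Literature.Analysis.FluidPDE.MikadoDisjointPipes
import Literature.Analysis.FluidPDE.IntermittentTimeProfiles
import Literature.Analysis.FluidPDE.CLPerturbation
import HarnessLib

/-!
# Intermittent jets on `𝕋^d` (Buckmaster–Vicol 2019 survey, §7.4): definitions and identities

Analysis/FluidPDE support file (everything proved; definitions are explicit constructions) for
the intermittent convex-integration scheme of T. Buckmaster, V. Vicol, *Convex integration and
phenomenologies in turbulence*, EMS Surv. Math. Sci. 6 (2019) = arXiv:1901.09023, §7.4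
(intermittent jets, after Buckmaster–Colombo–Vicol), realised with the Mikado tool-kit of the tree
(`MikadoFlows`, `MikadoRescaled`, `MikadoShiftedPipes`, `MikadoDisjointPipes`: concentrated pipe
profiles `ψ_x` of concentration `μ`, potentials `Δφ_x = ψ_x`, integer directions
`k_x = NashGeometric.dir x`, oscillation rescaling `y ↦ σ • y`) and the intermittent time profiles
`g_κ` of `IntermittentTimeProfiles` used as AXIAL profiles along the pipe (`JetAxialProfile`).

For parameters `J = (μ, κ, ω, σ, g)` (`Jet.Params`: transverse concentration `μ ≥ 1`, axial
concentration `κ ≥ 1`, temporal frequency `ω ≠ 0`, cell frequency `σ ≥ 1`, a bump `g` with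
`∫₀¹ g² = 1`), shifts `s : Index d → 𝕋^d` and a direction `x`:

* `Jet.eta J x t y = g_κ(σ k_x·Y + ωt)` (BV (7.16a): `ψ_(ξ) = ψ_{r_∥}(n_* r_⊥ λ(x·ξ + μt))`), the
  axial factor, with `Jet.etaD` the same for `(g_κ)'`; `∂ₗη = σ (k_x)ₗ η'`, `∂ₜη = ω η'`, hence the
  **key identity** `(k_x·∇)η = (σ|k_x|²/ω) ∂ₜη` (BV (7.20): "`(ξ·∇)ψ_(ξ) = μ⁻¹∂ₜψ_(ξ)`");
* `Jet.psiJ J s x = ψ_x(σ • (· - s_x))`, `Jet.phiJ` (`Δφ̃ = ψ̃`), the transverse factors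
  (BV (7.16b,c)), invariant along `k_x`;
* `Jet.W J s x t = η ψ̃ k_x` (BV (7.17)), `Jet.Wc = -((k_x·∇)η) ∇φ̃` (BV (7.21)) and the skew tensor
  `Jet.Om` (columns `η(∂ⱼφ̃ k_x - (k_x)ⱼ∇φ̃)`) with `div Om = W + Wc`, so that `div (W + Wc) = 0`
  and, for a scalar amplitude `b`, `div (b Om) = b (W + Wc) + (η∇φ̃·∇b) k_x - η (k_x·∇b) ∇φ̃`
  (BV (7.35)–(7.36): `w^{(p)} + w^{(c)} = curl curl (a V)`, here in the skew-tensor form of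
  Cheskidov–Luo (4.18));
* the fast product `Jet.fastF = η²ψ̃²` with `η²ψ̃² = 1 + G₀(σ • ·)`, `∫ G₀ = 0` (`Jet.fastBase`,
  BV (7.19), (7.34)), from the factorisation `∫ F(η) G(ψ̃) = (∫₀¹F∘g_κ)(∫ G∘ψ_x)`
  (`JetAxialProfile`) and the normalisations `∫₀¹ g_κ² = 1`, `∫ ψ_x² = 1`;
* pairwise disjoint supports of the `ψ̃_x` on `𝕋³` for the shifts `s_x = proj(σ⁻¹ p_x)`
  (`MikadoDisjointPipes`), i.e. BV (7.18) `W_(ξ) ⊗ W_(ξ') ≡ 0`;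
* the scaling of the inverse Laplacian under `y ↦ σ • y` (`invLaplacian_comp_nsmul`).

Quantitative bounds are in the sibling `IntermittentJetBounds`.

## References

* T. Buckmaster, V. Vicol, EMS Surv. Math. Sci. 6 (2019) = arXiv:1901.09023, §7.4 (7.13)–(7.24),
  §7.5.3 (7.33)–(7.38). [`BuckmasterVicol2020`]
* A. Cheskidov, X. Luo, Invent. Math. 229 (2022) = arXiv:2009.06596, §4.4 (4.16)–(4.18).
  [`CheskidovLuo2022`]
-/

noncomputable section

open MeasureTheory Set Function UnitAddTorus
open scoped ContDiff

namespace Literature.Analysis.FluidPDE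

namespace Jet

open FunctionSpaces FunctionSpaces.Torus Mikado NashGeometric Transverse

variable {d : Type*} [Fintype d] [DecidableEq d]

/-! ## Parameters -/

/-- **The parameters of an intermittent jet**: transverse concentration `μ`, axial concentration
`κ`, temporal frequency `ω`, cell frequency `σ ∈ ℕ`, and the axial bump `g`
(BV survey §7.4–§7.5.1: `r_⊥ = μ⁻¹` within a cell, `r_∥ = κ⁻¹`, `λ r_⊥ = σ`, `μ_{BV} = ω/(σ|k|²)`).
[cite: BuckmasterVicol2020, §7.5.1 (7.25)] -/
structure Params where
  /-- transverse concentration (`μ ≥ 1`) -/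
  μ : ℝ
  /-- axial concentration (`κ ≥ 1`) -/
  κ : ℝ
  /-- temporal frequency (`ω ≠ 0`), written `om` -/
  om : ℝ
  /-- cell frequency (`σ ≥ 1`) -/
  σ : ℕ
  /-- the axial bump -/
  g : ℝ → ℝ

/-- Admissible parameters. [cite: BuckmasterVicol2020, §7.4] -/
structure Params.Valid (J : Params) : Prop where
  hμ : 1 ≤ J.μ
  hκ : 1 ≤ J.κ
  hω : J.om ≠ 0
  hσ : 0 < J.σ
  hg : Intermittent.IsBump J.g
  hg1 : ∫ s in (0 : ℝ)..1, J.g s ^ 2 = 1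

variable (J : Params) (s : Index d → UnitAddTorus d)

/-- The axial profile `g_κ` (one-periodic). [cite: BuckmasterVicol2020, §7.4 (7.15)] -/
def prof : ℝ → ℝ := Intermittent.profile J.κ J.g

/-- `g_κ` is one-periodic. [folklore] -/
theorem prof_periodic : Periodic (prof J) 1 := Intermittent.profile_periodic J.κ J.g

/-- The integer frequency vector `σ k_x` of the axial factor. [folklore] -/
def nvec (x : Index d) : d → ℤ := fun l => (J.σ : ℤ) * dir x l

/-- **The axial factor** `η_x(t, y) = g_κ(σ k_x·Y + ω t)`. [cite: BuckmasterVicol2020, §7.4 (7.16a)] -/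
def eta (x : Index d) (t : ℝ) : UnitAddTorus d → ℝ := axialFn (prof_periodic J) ((nvec J) x) (J.om * t)

/-- The axial factor of the derivative profile, `η'_x(t, y) = (g_κ)'(σ k_x·Y + ω t)`. [folklore] -/
def etaD (x : Index d) (t : ℝ) : UnitAddTorus d → ℝ :=
  axialFn (periodic_deriv (prof_periodic J)) ((nvec J) x) (J.om * t)

/-- The axial factor of the second derivative profile `(g_κ)''`. [folklore] -/
def etaDD (x : Index d) (t : ℝ) : UnitAddTorus d → ℝ :=
  axialFn (periodic_deriv (periodic_deriv (prof_periodic J))) ((nvec J) x) (J.om * t)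

/-- **The transverse factor** `ψ̃_x = ψ_x(σ • (· - s_x))`. [cite: BuckmasterVicol2020, §7.4 (7.16c)] -/
def psiJ (x : Index d) : UnitAddTorus d → ℝ := fun y => psiR x J.μ J.σ (y - s x)

/-- **The transverse potential** `φ̃_x = σ⁻² φ_x(σ • (· - s_x))`, `Δφ̃ = ψ̃`. [cite: BuckmasterVicol2020, §7.4 (7.16b)] -/
def phiJ (x : Index d) : UnitAddTorus d → ℝ := fun y => phiR x J.μ J.σ (y - s x)

/-- **The intermittent jet** `W_x = η_x ψ̃_x k_x`. [cite: BuckmasterVicol2020, §7.4 (7.17)] -/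
def W (x : Index d) (t : ℝ) : UnitAddTorus d → EuclideanSpace ℝ d :=
  fun y => ((eta J) x t y * psiJ J s x y) • dirVec x

/-- **The incompressibility corrector of a jet** `W^{(c)}_x = -((k_x·∇)η_x) ∇φ̃_x`.
[cite: BuckmasterVicol2020, §7.4 (7.21)] -/
def Wc (x : Index d) (t : ℝ) : UnitAddTorus d → EuclideanSpace ℝ d :=
  fun y => -(dirD x ((eta J) x t) y) • Torus.gradient (phiJ J s x) y

/-- The transverse frame columns `∂ⱼφ̃ k_x - (k_x)ⱼ ∇φ̃` (skew). [folklore] -/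
def frame (x : Index d) (y : UnitAddTorus d) (j : d) : EuclideanSpace ℝ d :=
  Torus.partialDeriv j (phiJ J s x) y • dirVec x - ((dir x j : ℤ) : ℝ) • Torus.gradient (phiJ J s x) y

/-- **The skew potential of a jet**, by columns: `Om_x(t,y) eⱼ = η_x (∂ⱼφ̃ k_x - (k_x)ⱼ ∇φ̃)`,
with `div Om = W + W^{(c)}`. [cite: BuckmasterVicol2020, §7.5.3 (7.36)] -/
def Om (x : Index d) (t : ℝ) : UnitAddTorus d → d → EuclideanSpace ℝ d :=
  fun y j => (eta J) x t y • frame J s x y j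

/-- The action of the skew frame on a vector: `(∇φ̃·v) k_x - (k_x·v) ∇φ̃`. [folklore] -/
def frameApply (x : Index d) (y : UnitAddTorus d) (v : EuclideanSpace ℝ d) : EuclideanSpace ℝ d :=
  (∑ j, Torus.partialDeriv j (phiJ J s x) y * v j) • dirVec x - (∑ j, ((dir x j : ℤ) : ℝ) * v j) • Torus.gradient (phiJ J s x) y

/-- **The fast product** `η_x² ψ̃_x²` (the coefficient of `k_x ⊗ k_x` in `W_x ⊗ W_x`). [cite: BuckmasterVicol2020, §7.5.3 (7.34)] -/
def fastF (x : Index d) (t : ℝ) : UnitAddTorus d → ℝ := fun y => (eta J) x t y ^ 2 * psiJ J s x y ^ 2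

/-- The unit-cell version of the fast product minus its mean:
`G₀(t, z) = g̃_κ(k_x·Z + ωt)² ψ_x(z - σ • s_x)² - 1`, so that `η²ψ̃² = 1 + G₀(σ • ·)`. [folklore] -/
def fastBase (x : Index d) (t : ℝ) : UnitAddTorus d → ℝ :=
  fun z => axialFn (prof_periodic J) (dir x) (J.om * t) z ^ 2 * psi x J.μ (z - J.σ • s x) ^ 2 - 1

/-! ## The axial factor: smoothness and derivatives -/

section Axial

variable {J} (h : J.Valid)
include h

/-- The axial profile is smooth. [folklore] -/
theorem contDiff_prof : ContDiff ℝ ∞ (prof J) := h.hg.contDiff_profile h.hκ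

/-- `(g_κ)' = κ (g')_κ`. [folklore] -/
theorem deriv_prof : deriv (prof J) = fun r => J.κ * Intermittent.profile J.κ (deriv J.g) r :=
  h.hg.deriv_profile h.hκ

/-- `(g_κ)'` is smooth. [folklore] -/
theorem contDiff_deriv_prof : ContDiff ℝ ∞ (deriv (prof J)) := by
  rw [deriv_prof h]; exact contDiff_const.mul (h.hg.deriv.contDiff_profile h.hκ)

/-- `(g_κ)''` is smooth. [folklore] -/
theorem contDiff_deriv_deriv_prof : ContDiff ℝ ∞ (deriv (deriv (prof J))) :=
  (contDiff_deriv_prof h).deriv'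

/-- `η_x(t)` is smooth on `𝕋^d`. [folklore] -/
theorem isSmooth_eta (x : Index d) (t : ℝ) : IsSmooth ((eta J) x t) :=
  isSmooth_axialFn _ (contDiff_prof h) _ _

/-- `η'_x(t)` is smooth on `𝕋^d`. [folklore] -/
theorem isSmooth_etaD (x : Index d) (t : ℝ) : IsSmooth ((etaD J) x t) :=
  isSmooth_axialFn _ (contDiff_deriv_prof h) _ _

/-- `η''_x(t)` is smooth on `𝕋^d`. [folklore] -/
theorem isSmooth_etaDD (x : Index d) (t : ℝ) : IsSmooth ((etaDD J) x t) :=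
  isSmooth_axialFn _ (contDiff_deriv_deriv_prof h) _ _

/-- `(t, y) ↦ η_x(t, y)` is jointly smooth. [folklore] -/
theorem isSmoothSpaceTimeOn_eta (x : Index d) (S : Set ℝ) : Torus.IsSmoothSpaceTimeOn S ((eta J) x) := by
  unfold Torus.IsSmoothSpaceTimeOn eta
  exact (contDiff_stLift_axialFn _ (contDiff_prof h) ((nvec J) x) J.om).contDiffOn

/-- `(t, y) ↦ η'_x(t, y)` is jointly smooth. [folklore] -/
theorem isSmoothSpaceTimeOn_etaD (x : Index d) (S : Set ℝ) : Torus.IsSmoothSpaceTimeOn S ((etaD J) x) := by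
  unfold Torus.IsSmoothSpaceTimeOn etaD
  exact (contDiff_stLift_axialFn _ (contDiff_deriv_prof h) ((nvec J) x) J.om).contDiffOn

/-- `(t, y) ↦ η''_x(t, y)` is jointly smooth. [folklore] -/
theorem isSmoothSpaceTimeOn_etaDD (x : Index d) (S : Set ℝ) : Torus.IsSmoothSpaceTimeOn S ((etaDD J) x) := by
  unfold Torus.IsSmoothSpaceTimeOn etaDD
  exact (contDiff_stLift_axialFn _ (contDiff_deriv_deriv_prof h) ((nvec J) x) J.om).contDiffOn

/-- **`∂ₗ η_x = σ (k_x)ₗ η'_x`**. [cite: BuckmasterVicol2020, §7.4 (7.16a)] -/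
theorem partialDeriv_eta (x : Index d) (t : ℝ) (l : d) (y : UnitAddTorus d) :
    Torus.partialDeriv l ((eta J) x t) y = (J.σ : ℝ) * ((dir x l : ℤ) : ℝ) * (etaD J) x t y := by
  rw [eta, partialDeriv_axialFn _ ((contDiff_prof h).of_le (by exact_mod_cast le_top)), etaD, nvec]
  push_cast
  ring

/-- `∂ₗ η'_x = σ (k_x)ₗ η''_x`. [folklore] -/
theorem partialDeriv_etaD (x : Index d) (t : ℝ) (l : d) (y : UnitAddTorus d) :
    Torus.partialDeriv l ((etaD J) x t) y = (J.σ : ℝ) * ((dir x l : ℤ) : ℝ) * (etaDD J) x t y := by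
  rw [etaD, partialDeriv_axialFn _ ((contDiff_deriv_prof h).of_le (by exact_mod_cast le_top)), etaDD, nvec]
  push_cast
  ring

/-- **`∂ₜ η_x = ω η'_x`**. [cite: BuckmasterVicol2020, §7.4 (7.16a)] -/
theorem hasDerivAt_eta (x : Index d) (y : UnitAddTorus d) (t : ℝ) :
    HasDerivAt (fun t' => (eta J) x t' y) (J.om * (etaD J) x t y) t := by
  have h1 := hasDerivAt_axialFn_phase (prof_periodic J) ((contDiff_prof h).of_le (by exact_mod_cast le_top)) ((nvec J) x) y (J.om * t)
  have h2 : HasDerivAt (fun t' : ℝ => J.om * t') J.om t := by simpa using (hasDerivAt_id t).const_mul J.om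
  have := h1.comp t h2
  simpa [eta, etaD, Function.comp_def, mul_comm] using this

/-- `∂ₜ η'_x = ω η''_x`. [folklore] -/
theorem hasDerivAt_etaD (x : Index d) (y : UnitAddTorus d) (t : ℝ) :
    HasDerivAt (fun t' => (etaD J) x t' y) (J.om * (etaDD J) x t y) t := by
  have h1 := hasDerivAt_axialFn_phase (periodic_deriv (prof_periodic J)) ((contDiff_deriv_prof h).of_le (by exact_mod_cast le_top))
    ((nvec J) x) y (J.om * t)
  have h2 : HasDerivAt (fun t' : ℝ => J.om * t') J.om t := by simpa using (hasDerivAt_id t).const_mul J.om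
  have := h1.comp t h2
  simpa [etaD, etaDD, Function.comp_def, mul_comm] using this

omit h in
/-- `|k_x|²` as a real number. [folklore] -/
theorem sum_dir_sq_real (x : Index d) : (∑ l, (((dir x l : ℤ) : ℝ)) ^ 2) = ((∑ l, (dir x l) ^ 2 : ℤ) : ℝ) := by
  push_cast; rfl

/-- **`(k_x·∇) η_x = σ|k_x|² η'_x`**. [cite: BuckmasterVicol2020, §7.4 (7.20)] -/
theorem dirD_eta (x : Index d) (t : ℝ) (y : UnitAddTorus d) :
    dirD x ((eta J) x t) y = (J.σ : ℝ) * (∑ l, (((dir x l : ℤ) : ℝ)) ^ 2) * (etaD J) x t y := by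
  simp only [dirD, partialDeriv_eta h, Finset.sum_mul, Finset.mul_sum]
  exact Finset.sum_congr rfl fun l _ => by ring

/-- **The key identity of intermittent jets**: `(k_x·∇)η_x = (σ|k_x|²/ω) ∂ₜη_x`
(BV survey (7.20): "`(ξ·∇)ψ_(ξ) = μ⁻¹∂ₜψ_(ξ)`"). [cite: BuckmasterVicol2020, §7.4 (7.20)] -/
theorem dirD_eta_eq_deriv (x : Index d) (t : ℝ) (y : UnitAddTorus d) :
    dirD x ((eta J) x t) y = ((J.σ : ℝ) * (∑ l, (((dir x l : ℤ) : ℝ)) ^ 2) / J.om) * deriv (fun t' => (eta J) x t' y) t := by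
  rw [(hasDerivAt_eta h x y t).deriv, dirD_eta h]
  field_simp [h.hω]

end Axial

/-! ## The transverse factor and potential -/

section Transverse

variable {J} (h : J.Valid)
include h

/-- `ψ̃_x` is smooth. [folklore] -/
theorem isSmooth_psiJ (x : Index d) : IsSmooth (psiJ J s x) :=
  isSmooth_comp_sub (isSmooth_psiR x h.hμ J.σ) (s x)

/-- `φ̃_x` is smooth. [folklore] -/
theorem isSmooth_phiJ (x : Index d) : IsSmooth (phiJ J s x) :=
  isSmooth_comp_sub (isSmooth_phiR x h.hμ J.σ) (s x)

/-- **`Δ φ̃_x = ψ̃_x`**. [cite: BuckmasterVicol2020, §7.4 (7.15)] -/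
theorem laplacian_phiJ (x : Index d) (y : UnitAddTorus d) : Torus.laplacian (phiJ J s x) y = psiJ J s x y := by
  show Torus.laplacian (fun y => phiR x J.μ J.σ (y - s x)) y = _
  rw [laplacian_comp_sub]
  exact laplacian_phiR x h.hμ h.hσ _

/-- **`(k_x·∇) ψ̃_x = 0`** (the transverse factor does not vary along the pipe). [cite: BuckmasterVicol2020, §7.4] -/
theorem dirD_psiJ (x : Index d) (y : UnitAddTorus d) : dirD x (psiJ J s x) y = 0 := by
  have h1 : ∀ l, Torus.partialDeriv l (psiJ J s x) y = Torus.partialDeriv l (psiR x J.μ J.σ) (y - s x) := by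
    intro l
    show Torus.partialDeriv l (fun y => psiR x J.μ J.σ (y - s x)) y = _
    rw [partialDeriv_comp_sub]
  simp only [dirD, h1]
  exact dirD_psiR x h.hμ J.σ (y - s x)

omit h in
/-- `∂ₗ φ̃_x` in terms of the unshifted potential. [folklore] -/
theorem partialDeriv_phiJ (x : Index d) (l : d) (y : UnitAddTorus d) :
    Torus.partialDeriv l (phiJ J s x) y = Torus.partialDeriv l (phiR x J.μ J.σ) (y - s x) := by
  show Torus.partialDeriv l (fun y => phiR x J.μ J.σ (y - s x)) y = _
  rw [partialDeriv_comp_sub]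

/-- **`(k_x·∇) ∂ᵢφ̃_x = 0`**. [folklore] -/
theorem dirD_partialDeriv_phiJ (x : Index d) (i : d) (y : UnitAddTorus d) :
    dirD x (Torus.partialDeriv i (phiJ J s x)) y = 0 := by
  have e : Torus.partialDeriv i (phiJ J s x) = fun y => Torus.partialDeriv i (phiR x J.μ J.σ) (y - s x) :=
    funext (partialDeriv_phiJ s x i)
  have h1 : ∀ l, Torus.partialDeriv l (Torus.partialDeriv i (phiJ J s x)) y =
      Torus.partialDeriv l (Torus.partialDeriv i (phiR x J.μ J.σ)) (y - s x) := by
    intro l; rw [e, partialDeriv_comp_sub]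
  simp only [dirD, h1]
  exact dirD_partialDeriv_phiR x h.hμ h.hσ i (y - s x)

/-- **`k_x · ∇φ̃_x = 0`** (`∑ⱼ (k_x)ⱼ ∂ⱼφ̃_x = 0`). [folklore] -/
theorem dirD_phiJ (x : Index d) (y : UnitAddTorus d) : dirD x (phiJ J s x) y = 0 := by
  have h1 : ∀ l, Torus.partialDeriv l (phiJ J s x) y =
      ((J.σ : ℝ))⁻¹ * Torus.partialDeriv l (phi x J.μ) (J.σ • (y - s x)) := fun l => by
    rw [partialDeriv_phiJ s x l y, partialDeriv_phiR x h.hμ h.hσ]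
  have h0 := dirD_phi x h.hμ (J.σ • (y - s x))
  rw [dirD] at h0
  simp only [dirD, h1]
  calc ∑ j, ((dir x j : ℤ) : ℝ) * (((J.σ : ℝ))⁻¹ * Torus.partialDeriv j (phi x J.μ) (J.σ • (y - s x)))
      = ((J.σ : ℝ))⁻¹ * ∑ j, ((dir x j : ℤ) : ℝ) * Torus.partialDeriv j (phi x J.μ) (J.σ • (y - s x)) := by
        rw [Finset.mul_sum]; exact Finset.sum_congr rfl fun j _ => by ring
    _ = 0 := by rw [h0, mul_zero]

/-- `∇η_x · ∇φ̃_x = 0` (axial and transverse gradients are orthogonal). [folklore] -/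
theorem sum_partialDeriv_eta_mul_partialDeriv_phiJ (x : Index d) (t : ℝ) (y : UnitAddTorus d) :
    ∑ j, Torus.partialDeriv j ((eta J) x t) y * Torus.partialDeriv j (phiJ J s x) y = 0 := by
  simp only [partialDeriv_eta h, mul_assoc, ← Finset.mul_sum]
  have := dirD_phiJ s h x y
  rw [dirD] at this
  simp only [mul_comm ((etaD J) x t y), ← mul_assoc, ← Finset.sum_mul] at *
  rw [this]
  ring

end Transverse

/-! ## The skew potential and its divergence -/

section Skew

variable {J} (h : J.Valid)
include h

/-- The frame columns are smooth. [folklore] -/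
theorem isSmooth_frame_col (x : Index d) (j : d) : IsSmooth (fun y => frame J s x y j) :=
  (((isSmooth_phiJ s h x).partialDeriv j).smul' (isSmooth_const _)).sub ((isSmooth_phiJ s h x).gradient.smul _)

/-- The frame is skew-symmetric. [folklore] -/
theorem frame_skew (x : Index d) (y : UnitAddTorus d) (i j : d) : frame J s x y i j = -frame J s x y j i := by
  have hP : Torus.IsContDiff 1 (phiJ J s x) := (isSmooth_phiJ s h x).isContDiff (by simp)
  simp only [frame, PiLp.smul_apply, PiLp.sub_apply, smul_eq_mul, Torus.gradient_apply hP, dirVec]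
  ring

/-- **Divergence of an amplitude times the skew frame**: for smooth scalar `b`,
`div (b (∂ⱼφ̃ k - kⱼ∇φ̃))ⱼ = (b ψ̃) k + frameApply[∇b]`
(`Δφ̃ = ψ̃`, `(k·∇)∂ᵢφ̃ = 0`; the computation behind BV (7.36) / CL22 (4.18)). [cite: BuckmasterVicol2020, §7.5.3 (7.36)] -/
theorem tensorDivergence_smul_frame (x : Index d) {b : UnitAddTorus d → ℝ} (hb : IsSmooth b) (y : UnitAddTorus d) :
    Torus.tensorDivergence (fun z j => b z • frame J s x z j) y =
      (b y * psiJ J s x y) • dirVec x + frameApply J s x y (Torus.gradient b y) := by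
  have hP := isSmooth_phiJ s h x
  have h1 : ∀ {f : UnitAddTorus d → EuclideanSpace ℝ d}, IsSmooth f → Torus.IsContDiff 1 f :=
    fun hf => hf.isContDiff (by simp)
  have h1s : ∀ {f : UnitAddTorus d → ℝ}, IsSmooth f → Torus.IsContDiff 1 f := fun hf => hf.isContDiff (by simp)
  have hWs : ∀ j, IsSmooth (fun z => frame J s x z j) := isSmooth_frame_col s h x
  have hdW : ∀ j, Torus.partialDeriv j (fun z => frame J s x z j) y =
      Torus.partialDeriv j (Torus.partialDeriv j (phiJ J s x)) y • dirVec x -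
      ((dir x j : ℤ) : ℝ) • Torus.partialDeriv j (Torus.gradient (phiJ J s x)) y := by
    intro j
    have e : (fun z => frame J s x z j) = fun z => (fun z => Torus.partialDeriv j (phiJ J s x) z • dirVec x) z +
        (fun z => (-((dir x j : ℤ) : ℝ)) • Torus.gradient (phiJ J s x) z) z := by
      funext z; simp only [frame, neg_smul, sub_eq_add_neg]
    have hA : Torus.IsContDiff 1 (fun z => Torus.partialDeriv j (phiJ J s x) z • dirVec x) :=
      h1 ((hP.partialDeriv j).smul' (isSmooth_const _))
    have hB : Torus.IsContDiff 1 (fun z => (-((dir x j : ℤ) : ℝ)) • Torus.gradient (phiJ J s x) z) := h1 (hP.gradient.smul _)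
    rw [e, Torus.partialDeriv_add_apply hA hB, Torus.partialDeriv_smul' (h1s (hP.partialDeriv j)) (Torus.isContDiff_const _),
      Torus.partialDeriv_const_apply, smul_zero, add_zero,
      show (fun z => (-((dir x j : ℤ) : ℝ)) • Torus.gradient (phiJ J s x) z) = (-((dir x j : ℤ) : ℝ)) • Torus.gradient (phiJ J s x) from rfl,
      Torus.partialDeriv_const_smul (h1 hP.gradient)]
    simp [sub_eq_add_neg]
  have hkgrad : ∑ j, ((dir x j : ℤ) : ℝ) • Torus.partialDeriv j (Torus.gradient (phiJ J s x)) y = 0 := by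
    ext i
    rw [Torus.euclidean_sum_apply]
    simp only [PiLp.smul_apply, smul_eq_mul, PiLp.zero_apply]
    have e : ∀ j, Torus.partialDeriv j (Torus.gradient (phiJ J s x)) y i =
        Torus.partialDeriv j (Torus.partialDeriv i (phiJ J s x)) y := by
      intro j
      rw [← Torus.partialDeriv_apply_coord (h1 hP.gradient) j y i]
      congr 1; funext z; exact Torus.gradient_apply (h1s hP) z i
    simp_rw [e]
    exact dirD_partialDeriv_phiJ s h x i y
  have hlap : ∑ j, Torus.partialDeriv j (Torus.partialDeriv j (phiJ J s x)) y = psiJ J s x y := by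
    rw [← Torus.laplacian_eq_sum_partialDeriv_partialDeriv hP]; exact laplacian_phiJ s h x y
  unfold Torus.tensorDivergence
  simp_rw [Torus.partialDeriv_smul' (h1s hb) (h1 (hWs _)), hdW]
  rw [Finset.sum_add_distrib]
  have hfirst : ∑ j, Torus.partialDeriv j b y • frame J s x y j = frameApply J s x y (Torus.gradient b y) := by
    simp only [frame, frameApply, Torus.gradient_apply (h1s hb), smul_sub, smul_smul, Finset.sum_sub_distrib, ← Finset.sum_smul]
    congr 1
    all_goals first | rfl | (congr 1; exact Finset.sum_congr rfl fun j _ => mul_comm _ _)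
  have hsecond : ∑ j, b y • (Torus.partialDeriv j (Torus.partialDeriv j (phiJ J s x)) y • dirVec x -
      ((dir x j : ℤ) : ℝ) • Torus.partialDeriv j (Torus.gradient (phiJ J s x)) y) = (b y * psiJ J s x y) • dirVec x := by
    rw [← Finset.smul_sum, Finset.sum_sub_distrib, hkgrad, sub_zero, ← Finset.sum_smul, hlap, smul_smul]
  rw [hfirst, hsecond, add_comm]

/-- The frame applied to `∇η_x` is the corrector: `frameApply[∇η] = -((k·∇)η) ∇φ̃` (since
`∇φ̃·∇η = 0`). [folklore] -/
theorem frameApply_gradient_eta (x : Index d) (t : ℝ) (y : UnitAddTorus d) :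
    frameApply J s x y (Torus.gradient ((eta J) x t) y) = Wc J s x t y := by
  have hη : Torus.IsContDiff 1 ((eta J) x t) := (isSmooth_eta h x t).isContDiff (by simp)
  simp only [frameApply, Wc, Torus.gradient_apply hη, dirD]
  have h0 : ∑ j, Torus.partialDeriv j (phiJ J s x) y * Torus.partialDeriv j ((eta J) x t) y = 0 := by
    rw [← sum_partialDeriv_eta_mul_partialDeriv_phiJ s h x t y]
    exact Finset.sum_congr rfl fun j _ => mul_comm _ _
  rw [h0, zero_smul, zero_sub, neg_smul]

/-- **`div Om_x = W_x + W^{(c)}_x`**. [cite: BuckmasterVicol2020, §7.5.3 (7.36)] -/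
theorem tensorDivergence_Om (x : Index d) (t : ℝ) (y : UnitAddTorus d) :
    Torus.tensorDivergence (Om J s x t) y = W J s x t y + Wc J s x t y := by
  show Torus.tensorDivergence (fun z j => (eta J) x t z • frame J s x z j) y = _
  rw [tensorDivergence_smul_frame s h x (isSmooth_eta h x t), frameApply_gradient_eta s h x t y]
  rfl

/-- **Divergence with an amplitude**: `div (b Om_x) = b (W_x + W^{(c)}_x) + frameApply[η ∇b]`
(the amplitude-gradient corrector of BV (7.35): `curl(∇a × V) + ∇a × curl V`). [cite: BuckmasterVicol2020, §7.5.3 (7.35)] -/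
theorem tensorDivergence_smul_Om (x : Index d) (t : ℝ) {b : UnitAddTorus d → ℝ} (hb : IsSmooth b) (y : UnitAddTorus d) :
    Torus.tensorDivergence (fun z j => b z • Om J s x t z j) y =
      b y • (W J s x t y + Wc J s x t y) + frameApply J s x y ((eta J) x t y • Torus.gradient b y) := by
  have hη := isSmooth_eta h x t
  have hbη : IsSmooth (fun z => b z * (eta J) x t z) := by unfold IsSmooth at hb hη ⊢; exact hb.mul hη
  have e : (fun z j => b z • Om J s x t z j) = fun z j => (b z * (eta J) x t z) • frame J s x z j := by
    funext z j; simp only [Om, smul_smul]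
  rw [e, tensorDivergence_smul_frame s h x hbη]
  have h1b : Torus.IsContDiff 1 b := hb.isContDiff (by simp)
  have h1η : Torus.IsContDiff 1 ((eta J) x t) := hη.isContDiff (by simp)
  have hgrad : Torus.gradient (fun z => b z * (eta J) x t z) y = b y • Torus.gradient ((eta J) x t) y + (eta J) x t y • Torus.gradient b y := by
    ext i
    simp only [Torus.gradient_apply ((hbη).isContDiff (by simp)), PiLp.add_apply, PiLp.smul_apply, smul_eq_mul,
      Torus.gradient_apply h1b, Torus.gradient_apply h1η, Torus.partialDeriv_mul h1b h1η]
    ring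
  -- linearity of `frameApply` in the vector
  have hlin : ∀ (c : ℝ) (v w' : EuclideanSpace ℝ d), frameApply J s x y (c • v + w') =
      c • frameApply J s x y v + frameApply J s x y w' := by
    intro c v w'
    simp only [frameApply, PiLp.add_apply, PiLp.smul_apply, smul_eq_mul, mul_add, Finset.sum_add_distrib, add_smul,
      smul_sub, smul_smul, ← mul_assoc, mul_comm _ c, Finset.mul_sum]
    simp only [mul_assoc, ← Finset.mul_sum, mul_smul]
    abel
  rw [hgrad, hlin, frameApply_gradient_eta s h x t y, W, smul_add, smul_smul, ← mul_assoc]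
  abel

/-- `Om_x(t)` is smooth in space. [folklore] -/
theorem isSmooth_Om (x : Index d) (t : ℝ) : IsSmooth (Om J s x t) :=
  contDiff_pi.2 fun j => (isSmooth_eta h x t).smul' (isSmooth_frame_col s h x j)

/-- `Om_x` is skew-symmetric. [folklore] -/
theorem Om_skew (x : Index d) (t : ℝ) (y : UnitAddTorus d) (i j : d) : Om J s x t y i j = -Om J s x t y j i := by
  simp only [Om, PiLp.smul_apply, smul_eq_mul, frame_skew s h x y i j, mul_neg]

/-- `W_x(t)` is smooth in space. [folklore] -/
theorem isSmooth_W (x : Index d) (t : ℝ) : IsSmooth (W J s x t) := by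
  have : IsSmooth (fun y => (eta J) x t y * psiJ J s x y) := by
    have h1 := isSmooth_eta h x t; have h2 := isSmooth_psiJ s h x
    unfold IsSmooth at h1 h2 ⊢; exact h1.mul h2
  exact this.smul' (isSmooth_const _)

/-- `W^{(c)}_x(t)` is smooth in space. [folklore] -/
theorem isSmooth_Wc (x : Index d) (t : ℝ) : IsSmooth (Wc J s x t) := by
  have hη := isSmooth_eta h x t
  have hD : IsSmooth (fun y => -(dirD x ((eta J) x t) y)) := by
    have : IsSmooth (dirD x ((eta J) x t)) := by
      unfold dirD
      exact Torus.isSmooth_finset_sum _ fun j _ => by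
        have := (hη.partialDeriv j); unfold IsSmooth at this ⊢; exact contDiff_const.mul this
    unfold IsSmooth at this ⊢; exact this.neg
  exact hD.smul' (isSmooth_phiJ s h x).gradient

/-- **`div (W_x + W^{(c)}_x) = 0`** (`div div` of a skew tensor). [cite: BuckmasterVicol2020, §7.4 (7.21)] -/
theorem divergence_W_add_Wc (x : Index d) (t : ℝ) (y : UnitAddTorus d) :
    Torus.divergence (fun z => W J s x t z + Wc J s x t z) y = 0 := by
  have e : (fun z => W J s x t z + Wc J s x t z) = Torus.tensorDivergence (Om J s x t) :=
    funext fun z => (tensorDivergence_Om s h x t z).symm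
  rw [e]
  exact CL22.Datum.divergence_tensorDivergence_of_skew (isSmooth_Om s h x t) (fun z i j => Om_skew s h x t z i j) y

/-- `∫ (W_x + W^{(c)}_x) = 0`. [folklore] -/
theorem integral_W_add_Wc (x : Index d) (t : ℝ) : ∫ y, (W J s x t y + Wc J s x t y) = 0 := by
  have e : (fun z => W J s x t z + Wc J s x t z) = Torus.tensorDivergence (Om J s x t) :=
    funext fun z => (tensorDivergence_Om s h x t z).symm
  rw [e]
  unfold Torus.tensorDivergence
  rw [integral_finsetSum _ fun j _ => (((isSmooth_Om s h x t).column j).partialDeriv j).integrable]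
  exact Finset.sum_eq_zero fun j _ => Torus.integral_partialDeriv_eq_zero_holds ((isSmooth_Om s h x t).column j) j

end Skew

/-! ## The fast product `η²ψ̃²`: cell structure and mean -/

section Fast

variable {J} (h : J.Valid)
include h

omit [Fintype d] [DecidableEq d] h in
/-- `σ • proj v = proj (σ • v)`. [folklore] -/
theorem nsmul_proj (σ : ℕ) (v : EuclideanSpace ℝ d) : σ • proj v = proj ((σ : ℝ) • v) := by
  funext i
  rw [Pi.smul_apply, proj_apply, proj_apply, PiLp.smul_apply, smul_eq_mul, ← nsmul_eq_mul, AddCircle.coe_nsmul]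

omit h in
/-- **The cell structure of the fast product**: `η_x(t,y)² ψ̃_x(y)² = 1 + G₀(t, σ • y)`. [cite: BuckmasterVicol2020, §7.5.3 (7.34)] -/
theorem fastF_eq (x : Index d) (t : ℝ) (y : UnitAddTorus d) :
    fastF J s x t y = 1 + fastBase J s x t (J.σ • y) := by
  have e1 : (eta J) x t y = axialFn (prof_periodic J) (dir x) (J.om * t) (J.σ • y) := by
    rw [eta, axialFn_nsmul]; rfl
  simp only [fastF, fastBase, e1, psiJ, psiR, smul_sub]
  ring

/-- `G₀(t)` is smooth. [folklore] -/
theorem isSmooth_fastBase (x : Index d) (t : ℝ) : IsSmooth (fastBase J s x t) := by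
  have h1 : IsSmooth (axialFn (prof_periodic J) (dir x) (J.om * t)) := isSmooth_axialFn _ (contDiff_prof h) _ _
  have h2 : IsSmooth (fun z : UnitAddTorus d => psi x J.μ (z - J.σ • s x)) := isSmooth_comp_sub (isSmooth_psi x h.hμ) _
  unfold fastBase IsSmooth at *
  exact ((h1.pow 2).mul (h2.pow 2)).sub contDiff_const

omit h in
/-- `k_x · k_x ≠ 0`. [folklore] -/
theorem sum_dir_mul_dir_ne_zero (x : Index d) : ∑ l, ((dir x l : ℤ) : ℝ) * ((datum x).k l : ℝ) ≠ 0 := by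
  rw [datum_k]
  have hpos : 0 < ∑ l, ((dir x l : ℤ) : ℝ) * ((dir x l : ℤ) : ℝ) := by
    have hne := dir_ne_zero x
    obtain ⟨l, hl⟩ : ∃ l, dir x l ≠ 0 := by
      by_contra hcon
      push Not at hcon
      exact hne (funext hcon)
    calc (0 : ℝ) < ((dir x l : ℤ) : ℝ) * ((dir x l : ℤ) : ℝ) := by
          have : ((dir x l : ℤ) : ℝ) ≠ 0 := by exact_mod_cast hl
          exact mul_self_pos.2 this
      _ ≤ ∑ l, ((dir x l : ℤ) : ℝ) * ((dir x l : ℤ) : ℝ) :=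
          Finset.single_le_sum (fun l' _ => mul_self_nonneg (((dir x l' : ℤ) : ℝ))) (Finset.mem_univ l)
  exact hpos.ne'

omit h in
/-- **Factorisation of `∫ F(axial) G(transverse)`** on the unit cell: for a one-periodic
continuous `P`, continuous `F`, `G`, a phase `r` and a translation `s₀`,
`∫ F(P̃(χ_{k_x} z + r)) G(L_x(z - s₀)) dz = (∫₀¹ F∘P)(∫ G∘L_x)`. [cite: BuckmasterVicol2020, §7.4] -/
theorem integral_axial_transverse (x : Index d) {P : ℝ → ℝ} (hP : Periodic P 1) (hPc : Continuous P)
    {F : ℝ → ℝ} (hF : Continuous F) {G : UnitAddTorus (Slot x) → ℝ} (hG : Continuous G) (r : ℝ) (s₀ : UnitAddTorus d) :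
    ∫ z, F (axialFn hP (dir x) r z) * G ((datum x).hom (z - s₀)) =
      (∫ u in (0 : ℝ)..1, F (P u)) * ∫ z, G ((datum x).hom z) := by
  -- translate by `s₀`, absorbing the phase
  obtain ⟨ρ, hρ⟩ := QuotientAddGroup.mk_surjective (chi (dir x) s₀)
  have htrans : ∫ z, F (axialFn hP (dir x) r z) * G ((datum x).hom (z - s₀)) =
      ∫ z, F (axialFn hP (dir x) (r + ρ) z) * G ((datum x).hom z) := by
    rw [← integral_comp_sub (fun z => F (axialFn hP (dir x) (r + ρ) z) * G ((datum x).hom z)) s₀]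
    refine integral_congr_ae (ae_of_all _ fun z => ?_)
    simp only
    rw [axialFn_sub hP (dir x) (r + ρ) hρ.symm]
    ring_nf
  rw [htrans]
  have hGm : AEStronglyMeasurable G volume := hG.aestronglyMeasurable
  rw [integral_axialFn_mul_pull hP hPc (datum x) (sum_dir_mul_dir_ne_zero x) hF hGm]
  congr 1
  exact ((datum x).integral_pull G hGm).symm

/-- The case of the jet profile `g_κ` and the pipe profile: `∫ F(η-type) G(ψ_x(· - s₀)) = (∫₀¹ F∘g_κ)(∫ G∘ψ_x)`.
[cite: BuckmasterVicol2020, §7.4] -/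
theorem integral_axial_psi (x : Index d) {F : ℝ → ℝ} (hF : Continuous F) {G : ℝ → ℝ} (hG : Continuous G)
    (r : ℝ) (s₀ : UnitAddTorus d) :
    ∫ z, F (axialFn (prof_periodic J) (dir x) r z) * G (psi x J.μ (z - s₀)) =
      (∫ u in (0 : ℝ)..1, F ((prof J) u)) * ∫ z, G (psi x J.μ z) := by
  have hpsi : ∀ z, psi x J.μ z = psiT (datum x).c J.μ ((datum x).hom z) := fun z => rfl
  simp only [hpsi]
  exact integral_axial_transverse x (prof_periodic J) (contDiff_prof h).continuous hF
    (hG.comp (isSmooth_psiT (datum x).c h.hμ).continuous) r s₀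

/-- **`∫ G₀(t) = 0`**: the fast product has mean exactly `1` (`∫₀¹ g_κ² = 1`, `∫ ψ_x² = 1`).
[cite: BuckmasterVicol2020, §7.4 (7.19)] -/
theorem integral_fastBase (hd : 2 ≤ Fintype.card d) (x : Index d) (t : ℝ) : ∫ z, fastBase J s x t z = 0 := by
  have h1 : ∫ z, axialFn (prof_periodic J) (dir x) (J.om * t) z ^ 2 * psi x J.μ (z - J.σ • s x) ^ 2 = 1 := by
    have := integral_axial_psi h x (F := fun u => u ^ 2) (continuous_pow 2) (G := fun u => u ^ 2) (continuous_pow 2)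
      (J.om * t) (J.σ • s x)
    rw [this, integral_psi_sq hd x h.hμ, mul_one]
    have e : ∫ u in (0 : ℝ)..1, (prof J) u ^ 2 = 1 := by
      rw [prof, h.hg.intervalIntegral_profile_sq h.hκ, h.hg1]
    exact e
  have hint : Integrable (fun z => axialFn (prof_periodic J) (dir x) (J.om * t) z ^ 2 * psi x J.μ (z - J.σ • s x) ^ 2) volume := by
    have hc1 : Continuous (axialFn (prof_periodic J) (dir x) (J.om * t)) := (isSmooth_axialFn _ (contDiff_prof h) _ _).continuous
    have hc2 : Continuous (fun z : UnitAddTorus d => psi x J.μ (z - J.σ • s x)) :=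
      (isSmooth_comp_sub (isSmooth_psi x h.hμ) _).continuous
    exact ((hc1.pow 2).mul (hc2.pow 2)).integrable_unitAddTorus
  unfold fastBase
  rw [integral_sub hint (integrable_const 1), h1]
  simp

/-- **`∫ η_x² ψ̃_x² = 1`** for every `t`. [cite: BuckmasterVicol2020, §7.4 (7.19)] -/
theorem integral_fastF (hd : 2 ≤ Fintype.card d) (x : Index d) (t : ℝ) : ∫ y, fastF J s x t y = 1 := by
  have e : (fun y => fastF J s x t y) = fun y => 1 + fastBase J s x t (J.σ • y) := funext (fastF_eq s x t)
  have hG := isSmooth_fastBase s h x t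
  have hint : Integrable (fun y : UnitAddTorus d => fastBase J s x t (J.σ • y)) volume :=
    (isSmooth_comp_nsmul hG J.σ).continuous.integrable_unitAddTorus
  rw [e, integral_add (integrable_const 1) hint, integral_comp_nsmul h.hσ hG.continuous.aestronglyMeasurable,
    integral_fastBase s h hd x t]
  simp

end Fast

/-! ## Disjoint supports on `𝕋³` -/

section Disjoint

variable (J : Params)

/-- **The pre-shifts** `s_x = proj(σ⁻¹ p_x)` on `𝕋³`, so that `σ • s_x = proj p_x = shift x` is the
shift of `MikadoDisjointPipes`. [folklore] -/
def preShift (x : Index (Fin 3)) : UnitAddTorus (Fin 3) := proj (((J.σ : ℝ))⁻¹ • shiftVec x)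

variable {J} (h : J.Valid)
include h

/-- `σ • s_x = shift x`. [folklore] -/
theorem nsmul_preShift (x : Index (Fin 3)) : J.σ • (preShift J) x = shift x := by
  have hσ' : (J.σ : ℝ) ≠ 0 := by exact_mod_cast h.hσ.ne'
  rw [preShift, nsmul_proj, smul_smul, mul_inv_cancel₀ hσ', one_smul]
  rfl

/-- **Pairwise disjoint supports** (BV (7.18): `W_(ξ) ⊗ W_(ξ') ≡ 0` for `ξ ≠ ξ'`): for `μ ≥ 60`
and `x ≠ x'`, `ψ̃_x ψ̃_{x'} = 0` pointwise. [cite: BuckmasterVicol2020, §7.4 (7.18)] -/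
theorem psiJ_mul_psiJ_eq_zero {x x' : Index (Fin 3)} (hxx' : x ≠ x') (hμ : pipeConc ≤ J.μ) (y : UnitAddTorus (Fin 3)) :
    psiJ J (preShift J) x y * psiJ J (preShift J) x' y = 0 := by
  simp only [psiJ, psiR, smul_sub, nsmul_preShift h]
  exact psiS_mul_psiS_eq_zero hxx' hμ (J.σ • y)

end Disjoint

/-! ## Scaling of the inverse Laplacian under `y ↦ σ • y` -/

section Scaling

omit [DecidableEq d] in
/-- **`Δ⁻¹(G(σ•·)) = σ⁻² (Δ⁻¹G)(σ•·)`** for smooth zero-mean `G` and `σ ≥ 1` (both sides are smooth,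
of zero mean, with the same Laplacian `G(σ•·)`). [folklore] -/
theorem invLaplacian_comp_nsmul [Nonempty d] {G : UnitAddTorus d → ℝ} (hG : IsSmooth G) (hG0 : ∫ z, G z = 0)
    {σ : ℕ} (hσ : 0 < σ) :
    invLaplacian (fun y => G (σ • y)) = fun y => (((σ : ℝ)) ^ 2)⁻¹ * invLaplacian G (σ • y) := by
  classical
  have hσ' : (σ : ℝ) ≠ 0 := by exact_mod_cast hσ.ne'
  have hIG : IsSmooth (invLaplacian G) := isSmooth_invLaplacian hG
  set H : UnitAddTorus d → ℝ := fun y => (((σ : ℝ)) ^ 2)⁻¹ * invLaplacian G (σ • y) with hH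
  have hHs : IsSmooth H := by
    have := isSmooth_comp_nsmul hIG σ
    unfold IsSmooth at this ⊢
    exact contDiff_const.mul this
  -- `ΔH = G(σ•·)`
  have hlapH : Torus.laplacian H = fun y => G (σ • y) := by
    funext y
    have hc := isSmooth_comp_nsmul hIG σ
    have e : H = (((σ : ℝ)) ^ 2)⁻¹ • fun y => invLaplacian G (σ • y) := rfl
    rw [e, Torus.laplacian_const_smul_apply hc, laplacian_comp_nsmul hIG, laplacian_invLaplacian hG, hG0, sub_zero,
      smul_smul, smul_eq_mul, inv_mul_cancel₀ (pow_ne_zero 2 hσ'), one_mul]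
  -- `∫ H = 0`
  have hH0 : ∫ y, H y = 0 := by
    rw [hH]
    simp only
    rw [integral_const_mul, integral_comp_nsmul hσ hIG.continuous.aestronglyMeasurable, integral_invLaplacian hG, mul_zero]
  -- uniqueness
  have := invLaplacian_laplacian_of_integral_eq_zero hHs hH0
  rw [hlapH] at this
  exact this

end Scaling

end Jet

end Literature.Analysis.FluidPDE
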